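import Summits.Ventures.CertifiedManyBodySolver.Observables.PairLROTowerCharged
import Summits.Ventures.CertifiedManyBodySolver.Observables.RungLeavesPairAnchor
import HarnessLib

/-!
# OP1-C, part 5: the CELL consumer — charged one-point nodes on every cell of a chemical-potential grid
# whose hull contains the certified bracket `[μ₋(n), μ₊(n)]` give an unconditional pair-LRO ceiling

HONEST FRAMING: first certified bounds on pairing observables; not a superconductivity verdict; a ceiling
route, never presence. Crew hubbard-obs (D-0042), seat hubbard-obs-lit (`literature-prover-hubbard-obs-lit-g7-0`),
typing the consumer booked by hubbard-obs RULING (eu) d187 «(A3)» on top of the point theorem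
`liminf_pairFieldLRO_le_sq_of_onePoint_chargedStationary_bound_TT'` (PairLROTowerCharged, seat hubbard-obs-p1).
Zero compute; no definition; no named fact; no number; no `sorry`.

The point theorem needs the charged one-point node AT a supporting slope `μ_c ∈ [μ₋(n), μ₊(n)]` — the
subdifferential of the convex energy density `e(t,t',U,·)` at the density `n` — which certified energy rows
only BRACKET (`chemPot_mem_cell_of_mem_Icc`: a cap at `n₀`, floors at `n₁ ≤ n ≤ n₂` and a cap at `n₃`,
`n₀ < n₁`, `n₂ < n₃`, give `μ_lo ≤ μ₋(n) ≤ μ₊(n) ≤ μ_hi`) and never determine. The producer therefore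
certifies a node on EVERY CELL of a finite grid `μ_lo = m 0 ≤ m 1 ≤ ⋯ ≤ m (J+1) = μ_hi`; cell `j` is the
CLOSED interval `[m j, m (j+1)]`, on which ONE local word `w_j` (the charged equation-of-motion rows with their
multipliers frozen) and ONE constant `c_j` serve every `μ_c` of the cell (e.g. a certificate at a grid point
of the cell carrying the interval slack of `liminf_pairFieldLRO_le_sq_of_onePoint_chargedStationary_bound_TT'_near`,
PairLROTowerChargedBracket). This file reads such a family of cells into the leaf: `μ₋(n)` lies in the hull,
the closed cells cover the hull (`exists_mem_Icc_castSucc_succ_of_monotone`; neighbouring cells share their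
endpoint and a boundary point may be served by either neighbour — the proof takes the last cell whose left
end is `≤` the point), the point theorem applies in that cell, and the ceiling is the MAXIMUM over the cells
of `M_j² = (c_j − A_j + (Σ_σ μ_{jσ})(n/2 − ν_j))²` (sr-mbsolver-menu-3 MENU3-TLPINCER §7.3 «μ-grid with
interval slack»; hubbard-obs STATUS (eg1) / (ep4) / (eu1)).

* §1 `exists_mem_Icc_castSucc_succ_of_monotone` — the closed cells of a monotone grid cover its hull.
* §2 `liminf_pairFieldLRO_le_of_onePoint_chargedStationary_cover_TT'` — the mechanism at the generality
  of the point theorem (any `t, t'`, any form factor `g`, cells `[lo i, hi i]` indexed by an arbitrary type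
  `ι`, EVERY datum of the node indexed by the cell): if some supporting slope lies in some cell, then
  `liminf_k u_k ≤ B` for every `B` with `M_i² ≤ B` for all `i`.
* §3 `ObsPairLROCeilingAt_of_onePoint_chargedStationary_cells_bound_sq` — THE BOOKED FORM: `t = 1`,
  `g = dWaveFormFactor`, a monotone grid `m : Fin (J+2) → ℝ` (`J+1 ≥ 1` cells) with
  `m 0 ≤ μ₋(n)` and `μ₊(n) ≤ m (Fin.last (J+1))`, per-cell node hypotheses in exactly the shape the point
  theorem consumes at a point `μ_c`, quantified over `μ_c ∈ Icc (m j.castSucc) (m j.succ)`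
  ⇒ `ObsPairLROCeilingAt t' U n c'` at every `c' ≥ max_j M_j²` (stated as `∀ j, M_j² ≤ c'`).
* §4 `ObsPairLROCeilingAt_of_onePoint_chargedStationary_bracket_bound_sq` — the one-cell case `J = 0`
  (the bracket form), a sanity instance of §3; it is the point theorem read at `μ_c = μ₋(n)`.

References: T. Koma, H. Tasaki, J. Stat. Phys. 76 (1994) 745, Theorem 5 [KomaTasaki1994]; D. Ruelle,
*Statistical Mechanics* (1969) §3.4 [Ruelle1969]; E. H. Lieb, F. Y. Wu, Physica A 321 (2003) 1, §7
[LiebWuPhysicaA2003]; W. Pusz, S. L. Woronowicz, Comm. Math. Phys. 58 (1978) 273, §1 [PuszWoronowicz1978].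
-/

noncomputable section

namespace Summit.Ventures.CertifiedManyBodySolver.Observables

open Matrix Complex Finset Literature.MathematicalPhysics.QuantumLattice Literature.Probability.LatticeModels
open Literature.MathematicalPhysics.QuantumLattice.HubbardWave0 ThermodynamicLimit Filter Topology
open Literature.MathematicalPhysics.QuantumManyBody.StateRelaxation
open scoped ComplexOrder ComplexConjugate BigOperators

/-! ### §1 The closed cells of a monotone grid cover its hull -/

/-- **The closed cells of a monotone grid cover its hull.** For a monotone `m : Fin (J+2) → ℝ` and
`x ∈ [m 0, m (J+1)]` there is a cell `j : Fin (J+1)` with `m j.castSucc ≤ x ≤ m j.succ` (the last index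
`k` with `m k ≤ x` starts such a cell; at `k = J+1` the last cell serves). Shared endpoints are harmless:
the statement only asks for SOME cell. [folklore] -/
theorem exists_mem_Icc_castSucc_succ_of_monotone {J : ℕ} {m : Fin (J + 2) → ℝ} (hm : Monotone m) {x : ℝ}
    (hx : x ∈ Set.Icc (m 0) (m (Fin.last (J + 1)))) :
    ∃ j : Fin (J + 1), x ∈ Set.Icc (m j.castSucc) (m j.succ) := by
  classical
  obtain ⟨k, hk, hkmax⟩ := (univ.filter fun i : Fin (J + 2) => m i ≤ x).exists_max_image id
    ⟨0, mem_filter.2 ⟨mem_univ _, hx.1⟩⟩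
  have hkx : m k ≤ x := (mem_filter.1 hk).2
  by_cases hkl : k = Fin.last (J + 1)
  · subst hkl
    exact ⟨Fin.last J, (hm (Fin.le_last _)).trans hkx, by rw [Fin.succ_last]; exact hx.2⟩
  · obtain ⟨j, rfl⟩ := Fin.exists_castSucc_eq.2 hkl
    refine ⟨j, hkx, not_lt.1 fun hlt => ?_⟩
    have h : j.succ ≤ Fin.castSucc j := hkmax j.succ (mem_filter.2 ⟨mem_univ _, hlt.le⟩)
    exact absurd h (not_le.2 (Fin.castSucc_lt_succ (i := j)))

/-! ### §2 The mechanism: a supporting slope in some cell ⇒ the point theorem applies there -/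

section Cover

variable (g : Site 2 → ℝ)

/-- **OP1-C on a family of cells (general form).** Data of
`liminf_pairFieldLRO_le_sq_of_onePoint_chargedStationary_bound_TT'` (`U ≥ 0`, `0 < n < 2`) indexed by a
cell index `i : ι`: cells `[lo i, hi i]`, constants `c i, A i, κ i ≥ 0, u i ≥ e(t,t',U,n), ν i`, density
multipliers `μ i`, a local word `w_i ∈ 𝔄_{Λ_i}` with `w_i`, `w_iᴴ` even, its `N̂` double-commutator bounds
`hDDN₁/₂` with constant `DN i ≥ 0`, and the CHARGED one-point node of cell `i` valid at EVERY chemical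
potential `μ_c ∈ [lo i, hi i]`:
`c_i − A_i + Σ_σ μ_{iσ}(Re⟨ζ,N_σζ⟩/L² − ν_i) + κ_i(u_i − Re⟨ζ,H_Lζ⟩/L²) + Re⟨ζ,(K_L W_{i,L} − W_{i,L} K_L)ζ⟩/L² ≤ −Re⟨ζ,Δ_gζ⟩/L²`,
`K_L = H_L − μ_c N̂`, for `L ≥ L₁` and unit `ζ`. If SOME supporting slope `μ_s ∈ [μ₋(n), μ₊(n)]` lies in SOME
cell, then every family of unit `(rectN n L, S^z=0)`-sector ground states has `liminf_k u_k ≤ B` for every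
`B` with `(c_i − A_i + (Σ_σ μ_{iσ})(n/2 − ν_i))² ≤ B` for all `i` — the point theorem applied in the cell
containing `μ_s`. No finiteness, order or disjointness of the cells is used. [cite: KomaTasaki1994, Theorem 5]
[cite: PuszWoronowicz1978, §1] [cite: Ruelle1969, §3.4] -/
theorem liminf_pairFieldLRO_le_of_onePoint_chargedStationary_cover_TT' (t t' : ℝ) {U n : ℝ} (hU : 0 ≤ U)
    (hn0 : 0 < n) (hn2 : n < 2) {ι : Type*} (lo hi : ι → ℝ)
    (hcov : ∃ μs ∈ Set.Icc (chemPotMinusTT' t t' U n) (chemPotPlusTT' t t' U n),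
      ∃ i : ι, μs ∈ Set.Icc (lo i) (hi i))
    (c A κ u ν : ι → ℝ) (μ : ι → Fin 2 → ℝ) (hκ : ∀ i, 0 ≤ κ i)
    (hu : ∀ i, energyDensityTT' t t' U n ≤ u i)
    {Λw : ι → Finset (Site 2)} (wloc : ∀ i, FermionOp (Λw i))
    (hweven : ∀ i, wloc i ∈ carEvenSubalgebra (Finset.univ : Finset (Orb (PolySite (Λw i)))))
    (hwevenH : ∀ i, (wloc i)ᴴ ∈ carEvenSubalgebra (Finset.univ : Finset (Orb (PolySite (Λw i))))) (L₁ : ℕ)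
    (hInjw : ∀ i, ∀ L : ℕ, L₁ ≤ L → Set.InjOn (Torus.proj (d := 2) L) ↑(Λw i))
    (DN : ι → ℝ) (LN : ℕ) (hDN : ∀ i, 0 ≤ DN i)
    (hDDN₁ : ∀ i, ∀ (L : ℕ) [NeZero L] (hL : L₁ ≤ L), LN ≤ L → ∀ χ : Fock (Orb (FermionTorus 2 L)),
      star χ ⬝ᵥ χ = 1 →
      |(star χ ⬝ᵥ (((∑ v : TorusSite 2 L, relabel (Orb.translate v)
          (fermionEmbed (PolySite.toTorusEmb L (hInjw i L hL)) (((1 / 2 : ℂ)) • (wloc i + (wloc i)ᴴ)))) *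
        ((∑ v : TorusSite 2 L, relabel (Orb.translate v)
          (fermionEmbed (PolySite.toTorusEmb L (hInjw i L hL)) (((1 / 2 : ℂ)) • (wloc i + (wloc i)ᴴ)))) *
            totalNumber -
          totalNumber * (∑ v : TorusSite 2 L, relabel (Orb.translate v)
          (fermionEmbed (PolySite.toTorusEmb L (hInjw i L hL)) (((1 / 2 : ℂ)) • (wloc i + (wloc i)ᴴ))))) -
        ((∑ v : TorusSite 2 L, relabel (Orb.translate v)
          (fermionEmbed (PolySite.toTorusEmb L (hInjw i L hL)) (((1 / 2 : ℂ)) • (wloc i + (wloc i)ᴴ)))) *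
            totalNumber -
          totalNumber * (∑ v : TorusSite 2 L, relabel (Orb.translate v)
          (fermionEmbed (PolySite.toTorusEmb L (hInjw i L hL)) (((1 / 2 : ℂ)) • (wloc i + (wloc i)ᴴ))))) *
        (∑ v : TorusSite 2 L, relabel (Orb.translate v)
          (fermionEmbed (PolySite.toTorusEmb L (hInjw i L hL)) (((1 / 2 : ℂ)) • (wloc i + (wloc i)ᴴ))))) *ᵥ
          χ)).re| ≤ DN i * (L : ℝ) ^ 2)
    (hDDN₂ : ∀ i, ∀ (L : ℕ) [NeZero L] (hL : L₁ ≤ L), LN ≤ L → ∀ χ : Fock (Orb (FermionTorus 2 L)),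
      star χ ⬝ᵥ χ = 1 →
      |(star χ ⬝ᵥ (((∑ v : TorusSite 2 L, relabel (Orb.translate v)
          (fermionEmbed (PolySite.toTorusEmb L (hInjw i L hL)) ((I / 2 : ℂ) • ((wloc i)ᴴ - wloc i)))) *
        ((∑ v : TorusSite 2 L, relabel (Orb.translate v)
          (fermionEmbed (PolySite.toTorusEmb L (hInjw i L hL)) ((I / 2 : ℂ) • ((wloc i)ᴴ - wloc i)))) *
            totalNumber -
          totalNumber * (∑ v : TorusSite 2 L, relabel (Orb.translate v)
          (fermionEmbed (PolySite.toTorusEmb L (hInjw i L hL)) ((I / 2 : ℂ) • ((wloc i)ᴴ - wloc i))))) -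
        ((∑ v : TorusSite 2 L, relabel (Orb.translate v)
          (fermionEmbed (PolySite.toTorusEmb L (hInjw i L hL)) ((I / 2 : ℂ) • ((wloc i)ᴴ - wloc i)))) *
            totalNumber -
          totalNumber * (∑ v : TorusSite 2 L, relabel (Orb.translate v)
          (fermionEmbed (PolySite.toTorusEmb L (hInjw i L hL)) ((I / 2 : ℂ) • ((wloc i)ᴴ - wloc i))))) *
        (∑ v : TorusSite 2 L, relabel (Orb.translate v)
          (fermionEmbed (PolySite.toTorusEmb L (hInjw i L hL)) ((I / 2 : ℂ) • ((wloc i)ᴴ - wloc i))))) *ᵥ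
          χ)).re| ≤ DN i * (L : ℝ) ^ 2)
    (hboundC : ∀ i, ∀ μc ∈ Set.Icc (lo i) (hi i), ∀ (L : ℕ) [NeZero L] (hL : L₁ ≤ L)
      (ζ : Fock (Orb (FermionTorus 2 L))), star ζ ⬝ᵥ ζ = 1 →
      c i - A i + ∑ σ : Fin 2, μ i σ *
          ((star ζ ⬝ᵥ ((∑ y : FermionTorus 2 L, numberOp y σ) *ᵥ ζ)).re / (L : ℝ) ^ 2 - ν i) +
        κ i * (u i - (star ζ ⬝ᵥ (hubbardTorusTT' L t t' U *ᵥ ζ)).re / (L : ℝ) ^ 2) +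
        (star ζ ⬝ᵥ (((hubbardTorusTT' L t t' U - (μc : ℂ) • totalNumber) *
              (∑ v : TorusSite 2 L, relabel (Orb.translate v)
                (fermionEmbed (PolySite.toTorusEmb L (hInjw i L hL)) (wloc i))) -
            (∑ v : TorusSite 2 L, relabel (Orb.translate v)
                (fermionEmbed (PolySite.toTorusEmb L (hInjw i L hL)) (wloc i))) *
              (hubbardTorusTT' L t t' U - (μc : ℂ) • totalNumber)) *ᵥ ζ)).re / (L : ℝ) ^ 2 ≤
        -((expect (pairField g L) ζ).re / (L : ℝ) ^ 2))
    {B : ℝ} (hB : ∀ i, (c i - A i + (∑ σ : Fin 2, μ i σ) * (n / 2 - ν i)) ^ 2 ≤ B)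
    (ψ : ∀ L, Fock (Orb (FermionTorus 2 L)))
    (hψ : ∀ L, IsGroundStateInSector (hubbardTorusTT' L t t' U) (rectN n L) 0 (ψ L))
    (hψ1 : ∀ L, star (ψ L) ⬝ᵥ ψ L = 1) :
    liminf (fun k : ℕ => (∑ x ∈ halfOpenBox 2 (2 * k), ∑ y ∈ halfOpenBox 2 (2 * k),
        torusPullback (pairFieldCorr g ψ) (2 * k) x y) / ((#(halfOpenBox 2 (2 * k)) : ℝ)) ^ 2) atTop ≤ B := by
  obtain ⟨μs, hμs, i, hi⟩ := hcov
  exact (liminf_pairFieldLRO_le_sq_of_onePoint_chargedStationary_bound_TT' g t t' hU hn0 hn2 (μ i) (hκ i)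
    (hu i) hμs (wloc i) (hweven i) (hwevenH i) L₁ (hInjw i) LN (hDN i) (hDDN₁ i) (hDDN₂ i)
    (hboundC i μs hi) ψ hψ hψ1).trans (hB i)

end Cover

/-! ### §3 The booked form: a monotone grid whose hull contains `[μ₋(n), μ₊(n)]` ⇒ the leaf -/

section Cells

variable {tp U n : ℝ}

/-- **OP1-C CELL CONSUMER (hubbard-obs RULING (eu) d187 «(A3)»).** At the anchor `(U, n, t')` with `U ≥ 0`,
`0 < n < 2`: a monotone grid `m : Fin (J+2) → ℝ` of `J+1 ≥ 1` closed cells `[m j.castSucc, m j.succ]`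
whose hull contains the certified chemical-potential bracket, `m 0 ≤ μ₋(n)` and `μ₊(n) ≤ m (Fin.last (J+1))`
(from four certified energy rows by `chemPot_mem_cell_of_mem_Icc`, up to a `norm_num` comparison of the
grid ends with the two chords), and for every cell `j` the data of the point theorem
`liminf_pairFieldLRO_le_sq_of_onePoint_chargedStationary_bound_TT'` at `t = 1`, `g = dWaveFormFactor`
(constants `c j, A j, κ j ≥ 0, u j ≥ e(1,t',U,n), ν j`, density multipliers `μ j`, a local word `w_j` with
`w_j`, `w_jᴴ` even and its `N̂` double-commutator bounds with constant `DN j ≥ 0`) with the CHARGED one-point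
node of cell `j` valid at EVERY `μ_c ∈ Icc (m j.castSucc) (m j.succ)` — in the SAME shape the point theorem
consumes at a point `μ_c`. Conclusion: the leaf `ObsPairLROCeilingAt t' U n c'` at every
`c' ≥ max_j (c_j − A_j + (Σ_σ μ_{jσ})(n/2 − ν_j))²`. Proof: `μ₋(n) ∈ [μ₋(n), μ₊(n)]` (`μ₋ ≤ μ₊`,
`chemPotMinusTT'_le_chemPotPlusTT'`) lies in the hull, hence in some closed cell (§1; a boundary slope is
served by either neighbour), and §2 applies. [cite: KomaTasaki1994, Theorem 5] [cite: Ruelle1969, §3.4]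
[cite: LiebWuPhysicaA2003, §7] -/
theorem ObsPairLROCeilingAt_of_onePoint_chargedStationary_cells_bound_sq (hU : 0 ≤ U) (hn0 : 0 < n)
    (hn2 : n < 2) {J : ℕ} (m : Fin (J + 2) → ℝ) (hm : Monotone m)
    (hlo : m 0 ≤ chemPotMinusTT' 1 tp U n) (hhi : chemPotPlusTT' 1 tp U n ≤ m (Fin.last (J + 1)))
    (c A κ u ν : Fin (J + 1) → ℝ) (μ : Fin (J + 1) → Fin 2 → ℝ) (hκ : ∀ j, 0 ≤ κ j)
    (hu : ∀ j, energyDensityTT' 1 tp U n ≤ u j)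
    {Λw : Fin (J + 1) → Finset (Site 2)} (wloc : ∀ j, FermionOp (Λw j))
    (hweven : ∀ j, wloc j ∈ carEvenSubalgebra (Finset.univ : Finset (Orb (PolySite (Λw j)))))
    (hwevenH : ∀ j, (wloc j)ᴴ ∈ carEvenSubalgebra (Finset.univ : Finset (Orb (PolySite (Λw j))))) (L₁ : ℕ)
    (hInjw : ∀ j, ∀ L : ℕ, L₁ ≤ L → Set.InjOn (Torus.proj (d := 2) L) ↑(Λw j))
    (DN : Fin (J + 1) → ℝ) (LN : ℕ) (hDN : ∀ j, 0 ≤ DN j)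
    (hDDN₁ : ∀ j, ∀ (L : ℕ) [NeZero L] (hL : L₁ ≤ L), LN ≤ L → ∀ χ : Fock (Orb (FermionTorus 2 L)),
      star χ ⬝ᵥ χ = 1 →
      |(star χ ⬝ᵥ (((∑ v : TorusSite 2 L, relabel (Orb.translate v)
          (fermionEmbed (PolySite.toTorusEmb L (hInjw j L hL)) (((1 / 2 : ℂ)) • (wloc j + (wloc j)ᴴ)))) *
        ((∑ v : TorusSite 2 L, relabel (Orb.translate v)
          (fermionEmbed (PolySite.toTorusEmb L (hInjw j L hL)) (((1 / 2 : ℂ)) • (wloc j + (wloc j)ᴴ)))) *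
            totalNumber -
          totalNumber * (∑ v : TorusSite 2 L, relabel (Orb.translate v)
          (fermionEmbed (PolySite.toTorusEmb L (hInjw j L hL)) (((1 / 2 : ℂ)) • (wloc j + (wloc j)ᴴ))))) -
        ((∑ v : TorusSite 2 L, relabel (Orb.translate v)
          (fermionEmbed (PolySite.toTorusEmb L (hInjw j L hL)) (((1 / 2 : ℂ)) • (wloc j + (wloc j)ᴴ)))) *
            totalNumber -
          totalNumber * (∑ v : TorusSite 2 L, relabel (Orb.translate v)
          (fermionEmbed (PolySite.toTorusEmb L (hInjw j L hL)) (((1 / 2 : ℂ)) • (wloc j + (wloc j)ᴴ))))) *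
        (∑ v : TorusSite 2 L, relabel (Orb.translate v)
          (fermionEmbed (PolySite.toTorusEmb L (hInjw j L hL)) (((1 / 2 : ℂ)) • (wloc j + (wloc j)ᴴ))))) *ᵥ
          χ)).re| ≤ DN j * (L : ℝ) ^ 2)
    (hDDN₂ : ∀ j, ∀ (L : ℕ) [NeZero L] (hL : L₁ ≤ L), LN ≤ L → ∀ χ : Fock (Orb (FermionTorus 2 L)),
      star χ ⬝ᵥ χ = 1 →
      |(star χ ⬝ᵥ (((∑ v : TorusSite 2 L, relabel (Orb.translate v)
          (fermionEmbed (PolySite.toTorusEmb L (hInjw j L hL)) ((I / 2 : ℂ) • ((wloc j)ᴴ - wloc j)))) *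
        ((∑ v : TorusSite 2 L, relabel (Orb.translate v)
          (fermionEmbed (PolySite.toTorusEmb L (hInjw j L hL)) ((I / 2 : ℂ) • ((wloc j)ᴴ - wloc j)))) *
            totalNumber -
          totalNumber * (∑ v : TorusSite 2 L, relabel (Orb.translate v)
          (fermionEmbed (PolySite.toTorusEmb L (hInjw j L hL)) ((I / 2 : ℂ) • ((wloc j)ᴴ - wloc j))))) -
        ((∑ v : TorusSite 2 L, relabel (Orb.translate v)
          (fermionEmbed (PolySite.toTorusEmb L (hInjw j L hL)) ((I / 2 : ℂ) • ((wloc j)ᴴ - wloc j)))) *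
            totalNumber -
          totalNumber * (∑ v : TorusSite 2 L, relabel (Orb.translate v)
          (fermionEmbed (PolySite.toTorusEmb L (hInjw j L hL)) ((I / 2 : ℂ) • ((wloc j)ᴴ - wloc j))))) *
        (∑ v : TorusSite 2 L, relabel (Orb.translate v)
          (fermionEmbed (PolySite.toTorusEmb L (hInjw j L hL)) ((I / 2 : ℂ) • ((wloc j)ᴴ - wloc j))))) *ᵥ
          χ)).re| ≤ DN j * (L : ℝ) ^ 2)
    (hboundC : ∀ j, ∀ μc ∈ Set.Icc (m j.castSucc) (m j.succ), ∀ (L : ℕ) [NeZero L] (hL : L₁ ≤ L)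
      (ζ : Fock (Orb (FermionTorus 2 L))), star ζ ⬝ᵥ ζ = 1 →
      c j - A j + ∑ σ : Fin 2, μ j σ *
          ((star ζ ⬝ᵥ ((∑ y : FermionTorus 2 L, numberOp y σ) *ᵥ ζ)).re / (L : ℝ) ^ 2 - ν j) +
        κ j * (u j - (star ζ ⬝ᵥ (hubbardTorusTT' L 1 tp U *ᵥ ζ)).re / (L : ℝ) ^ 2) +
        (star ζ ⬝ᵥ (((hubbardTorusTT' L 1 tp U - (μc : ℂ) • totalNumber) *
              (∑ v : TorusSite 2 L, relabel (Orb.translate v)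
                (fermionEmbed (PolySite.toTorusEmb L (hInjw j L hL)) (wloc j))) -
            (∑ v : TorusSite 2 L, relabel (Orb.translate v)
                (fermionEmbed (PolySite.toTorusEmb L (hInjw j L hL)) (wloc j))) *
              (hubbardTorusTT' L 1 tp U - (μc : ℂ) • totalNumber)) *ᵥ ζ)).re / (L : ℝ) ^ 2 ≤
        -((expect (pairField dWaveFormFactor L) ζ).re / (L : ℝ) ^ 2))
    {c' : ℚ} (hc' : ∀ j, (c j - A j + (∑ σ : Fin 2, μ j σ) * (n / 2 - ν j)) ^ 2 ≤ ((c' : ℚ) : ℝ)) :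
    ObsPairLROCeilingAt tp U n c' := by
  intro ψ hψ hψ1
  have hmp := chemPotMinusTT'_le_chemPotPlusTT' 1 tp hU hn0 hn2
  obtain ⟨j, hj⟩ := exists_mem_Icc_castSucc_succ_of_monotone hm
    (x := chemPotMinusTT' 1 tp U n) ⟨hlo, hmp.trans hhi⟩
  exact liminf_pairFieldLRO_le_of_onePoint_chargedStationary_cover_TT' dWaveFormFactor 1 tp hU hn0 hn2
    (fun j : Fin (J + 1) => m j.castSucc) (fun j => m j.succ) ⟨_, ⟨le_rfl, hmp⟩, j, hj⟩ c A κ u ν μ hκ hu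
    wloc hweven hwevenH L₁ hInjw DN LN hDN hDDN₁ hDDN₂ hboundC hc' ψ hψ hψ1

/-! ### §4 Sanity: the one-cell case is the bracket form (the point theorem at `μ_c = μ₋(n)`) -/

/-- **One cell (`J = 0`): the bracket form.** A single charged node (one word `w`, one constant `c`) valid
at EVERY `μ_c` of a bracket `[μ_lo, μ_hi] ⊇ [μ₋(n), μ₊(n)]` gives the leaf `ObsPairLROCeilingAt t' U n c'`
at every `c' ≥ (c − A + (Σ_σ μ_σ)(n/2 − ν))²` — §3 with the grid `![μ_lo, μ_hi]`; equivalently the point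
theorem `liminf_pairFieldLRO_le_sq_of_onePoint_chargedStationary_bound_TT'` at the supporting slope
`μ_c = μ₋(n) ∈ [μ_lo, μ_hi]`. [cite: KomaTasaki1994, Theorem 5] [cite: Ruelle1969, §3.4] -/
theorem ObsPairLROCeilingAt_of_onePoint_chargedStationary_bracket_bound_sq (hU : 0 ≤ U) (hn0 : 0 < n)
    (hn2 : n < 2) {μlo μhi : ℝ}
    (hlo : μlo ≤ chemPotMinusTT' 1 tp U n) (hhi : chemPotPlusTT' 1 tp U n ≤ μhi)
    {c A κ u ν : ℝ} (μ : Fin 2 → ℝ) (hκ : 0 ≤ κ) (hu : energyDensityTT' 1 tp U n ≤ u)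
    {Λw : Finset (Site 2)} (wloc : FermionOp Λw)
    (hweven : wloc ∈ carEvenSubalgebra (Finset.univ : Finset (Orb (PolySite Λw))))
    (hwevenH : wlocᴴ ∈ carEvenSubalgebra (Finset.univ : Finset (Orb (PolySite Λw)))) (L₁ : ℕ)
    (hInjw : ∀ L : ℕ, L₁ ≤ L → Set.InjOn (Torus.proj (d := 2) L) ↑Λw)
    {DN : ℝ} (LN : ℕ) (hDN : 0 ≤ DN)
    (hDDN₁ : ∀ (L : ℕ) [NeZero L] (hL : L₁ ≤ L), LN ≤ L → ∀ χ : Fock (Orb (FermionTorus 2 L)), star χ ⬝ᵥ χ = 1 →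
      |(star χ ⬝ᵥ (((∑ v : TorusSite 2 L, relabel (Orb.translate v)
          (fermionEmbed (PolySite.toTorusEmb L (hInjw L hL)) (((1 / 2 : ℂ)) • (wloc + wlocᴴ)))) *
        ((∑ v : TorusSite 2 L, relabel (Orb.translate v)
          (fermionEmbed (PolySite.toTorusEmb L (hInjw L hL)) (((1 / 2 : ℂ)) • (wloc + wlocᴴ)))) * totalNumber -
          totalNumber * (∑ v : TorusSite 2 L, relabel (Orb.translate v)
          (fermionEmbed (PolySite.toTorusEmb L (hInjw L hL)) (((1 / 2 : ℂ)) • (wloc + wlocᴴ))))) -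
        ((∑ v : TorusSite 2 L, relabel (Orb.translate v)
          (fermionEmbed (PolySite.toTorusEmb L (hInjw L hL)) (((1 / 2 : ℂ)) • (wloc + wlocᴴ)))) * totalNumber -
          totalNumber * (∑ v : TorusSite 2 L, relabel (Orb.translate v)
          (fermionEmbed (PolySite.toTorusEmb L (hInjw L hL)) (((1 / 2 : ℂ)) • (wloc + wlocᴴ))))) *
        (∑ v : TorusSite 2 L, relabel (Orb.translate v)
          (fermionEmbed (PolySite.toTorusEmb L (hInjw L hL)) (((1 / 2 : ℂ)) • (wloc + wlocᴴ))))) *ᵥ χ)).re| ≤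
        DN * (L : ℝ) ^ 2)
    (hDDN₂ : ∀ (L : ℕ) [NeZero L] (hL : L₁ ≤ L), LN ≤ L → ∀ χ : Fock (Orb (FermionTorus 2 L)), star χ ⬝ᵥ χ = 1 →
      |(star χ ⬝ᵥ (((∑ v : TorusSite 2 L, relabel (Orb.translate v)
          (fermionEmbed (PolySite.toTorusEmb L (hInjw L hL)) ((I / 2 : ℂ) • (wlocᴴ - wloc)))) *
        ((∑ v : TorusSite 2 L, relabel (Orb.translate v)
          (fermionEmbed (PolySite.toTorusEmb L (hInjw L hL)) ((I / 2 : ℂ) • (wlocᴴ - wloc)))) * totalNumber -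
          totalNumber * (∑ v : TorusSite 2 L, relabel (Orb.translate v)
          (fermionEmbed (PolySite.toTorusEmb L (hInjw L hL)) ((I / 2 : ℂ) • (wlocᴴ - wloc))))) -
        ((∑ v : TorusSite 2 L, relabel (Orb.translate v)
          (fermionEmbed (PolySite.toTorusEmb L (hInjw L hL)) ((I / 2 : ℂ) • (wlocᴴ - wloc)))) * totalNumber -
          totalNumber * (∑ v : TorusSite 2 L, relabel (Orb.translate v)
          (fermionEmbed (PolySite.toTorusEmb L (hInjw L hL)) ((I / 2 : ℂ) • (wlocᴴ - wloc))))) *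
        (∑ v : TorusSite 2 L, relabel (Orb.translate v)
          (fermionEmbed (PolySite.toTorusEmb L (hInjw L hL)) ((I / 2 : ℂ) • (wlocᴴ - wloc))))) *ᵥ χ)).re| ≤
        DN * (L : ℝ) ^ 2)
    (hboundC : ∀ μc ∈ Set.Icc μlo μhi, ∀ (L : ℕ) [NeZero L] (hL : L₁ ≤ L)
      (ζ : Fock (Orb (FermionTorus 2 L))), star ζ ⬝ᵥ ζ = 1 →
      c - A + ∑ σ : Fin 2, μ σ *
          ((star ζ ⬝ᵥ ((∑ y : FermionTorus 2 L, numberOp y σ) *ᵥ ζ)).re / (L : ℝ) ^ 2 - ν) +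
        κ * (u - (star ζ ⬝ᵥ (hubbardTorusTT' L 1 tp U *ᵥ ζ)).re / (L : ℝ) ^ 2) +
        (star ζ ⬝ᵥ (((hubbardTorusTT' L 1 tp U - (μc : ℂ) • totalNumber) *
              (∑ v : TorusSite 2 L, relabel (Orb.translate v)
                (fermionEmbed (PolySite.toTorusEmb L (hInjw L hL)) wloc)) -
            (∑ v : TorusSite 2 L, relabel (Orb.translate v)
                (fermionEmbed (PolySite.toTorusEmb L (hInjw L hL)) wloc)) *
              (hubbardTorusTT' L 1 tp U - (μc : ℂ) • totalNumber)) *ᵥ ζ)).re / (L : ℝ) ^ 2 ≤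
        -((expect (pairField dWaveFormFactor L) ζ).re / (L : ℝ) ^ 2))
    {c' : ℚ} (hc' : (c - A + (∑ σ : Fin 2, μ σ) * (n / 2 - ν)) ^ 2 ≤ ((c' : ℚ) : ℝ)) :
    ObsPairLROCeilingAt tp U n c' := by
  have hle : μlo ≤ μhi := hlo.trans ((chemPotMinusTT'_le_chemPotPlusTT' 1 tp hU hn0 hn2).trans hhi)
  have hm : Monotone (![μlo, μhi] : Fin 2 → ℝ) := by
    refine Fin.monotone_iff_le_succ.2 fun i => ?_
    fin_cases i
    simpa using hle
  refine ObsPairLROCeilingAt_of_onePoint_chargedStationary_cells_bound_sq (J := 0) hU hn0 hn2 ![μlo, μhi] hm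
    (by simpa using hlo) (by simpa using hhi) (fun _ => c) (fun _ => A) (fun _ => κ) (fun _ => u) (fun _ => ν)
    (fun _ => μ) (fun _ => hκ) (fun _ => hu) (Λw := fun _ => Λw) (fun _ => wloc) (fun _ => hweven)
    (fun _ => hwevenH) L₁ (fun _ => hInjw) (fun _ => DN) LN (fun _ => hDN) (fun _ => hDDN₁) (fun _ => hDDN₂)
    (fun j μc hμc => hboundC μc ?_) (fun _ => hc')
  obtain rfl : j = 0 := Fin.eq_zero j
  simpa using hμc

end Cells

end Summit.Ventures.CertifiedManyBodySolver.Observables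

end
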